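import Literature.NumberTheory.Automorphic.UnitaryGroupTruncatedKernelClassIntegrableOfRowsTwo
import Literature.NumberTheory.Automorphic.UnitaryGroupBorelSiegelSetThinTwo
import Literature.NumberTheory.Automorphic.UnitaryGroupBorelSiegelSetTwo
import Literature.NumberTheory.Automorphic.UnitaryGroupBorelSiegelSetStructureTwo
import Literature.NumberTheory.Automorphic.UnitaryGroupSiegelRootNormDecayTwo
import Literature.NumberTheory.Automorphic.UnitaryGroupTorusSiegelSetTwo
import Literature.NumberTheory.Automorphic.UnitaryGroupLineConjOneFactorTwo
import Literature.NumberTheory.Automorphic.UnitaryGroupBorelThinSetIntegralTwo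
import Literature.NumberTheory.Automorphic.UnitaryGroupLineConjFundamentalDomainTwo
import Literature.NumberTheory.Automorphic.UnitaryGroupTorusSiegelIntegral
import Literature.NumberTheory.Automorphic.LocalTestFunctionTestClass
import HarnessLib

/-!
# Per-class integrability of `k^T_𝔬` on `U(J₂)` from the Siegel set: the LAW 1 closer of the H-side
# modulo the level depth of the dilated line domains (the `N = 2` twin of ★ `UnitaryGroupTruncatedKernelIntegrableOfSiegel`)
(Arthur, *A trace formula for reductive groups I*, Duke Math. J. 45 (1978), Thm. 7.1 and §8; Rogawski,
*Automorphic Representations of Unitary Groups in Three Variables* (1990), §2.2 p. 13: «For `T` sufficiently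
regular, `k^T(x)` is integrable over `𝐙G\𝐆` … Furthermore, `k^T_𝔬` is integrable», with «`G = U(3)`, `U(2)`,
or `U(2) × U(1)`», p. 98; Borel, *Introduction aux groupes arithmétiques* (1969), §12–§13.)

Topic `NumberTheory/Automorphic`; namespace `Literature.NumberTheory.Automorphic.UnitaryGroup`. THEOREMS ONLY
(no definition, no named fact, no instance, no notation, no `sorry`). H-side copy of LAWS 1–5 for
`H = U(Φ₂) × U(Φ₁)` (hodgecm-mathlib, F0P3a LEAD WORD #123∕#124; census `CENSUS-LAWS-Hside` §3 LAW 1 «closer»;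
desk TABLE #1 row (H-L1-cusp), NEXT-3 item (R4c)). It feeds the `U(J₂)` row package `hrows` of ★
`truncatedKernelClassIntegrable_of_rows_two` (`UnitaryGroupTruncatedKernelClassIntegrableOfRowsTwo`) with the
landed `N = 2` rows:
* ★ `exists_torusSiegelSet_two` — the torus Siegel set `S_T` of `U(J₂)` (closed, torus, EXPORT
  `d₀ = w · z(eˢ)`, COVER `T(𝔸_F) = T(F) · S_T`, LETTER `d₀⁻¹d₁ ∈ R` above height 1, BALANCE
  `‖(d₀⁻¹d₁)_w‖ ≲ H^{-2/[E:ℚ]}`);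
* ★ `exists_isCompact_cover_two` — `Ω` and the Borel Siegel set `S = Ω · S_T · K_B` covering `G(𝔸)` mod `B(F)`;
  ★ `exists_isCompact_structure_of_mem_siegel_two` — the structure clause; ★ every-`N`
  `isClosed_mul_mul_setOf_adelicVal_mem` ∕ `mul_mem_mul_mul_setOf_adelicVal_mem`;
* ★ `exists_isCompact_conj_mem_two` (the joint (P1) at `N = 2`, `UnitaryGroupBorelSiegelSetThinTwo`) with the
  every-`N` ★ `mul_mul_subset_thin` ∕ `isClosed_mul_setOf_torusPart` — the THIN superset of `S`;
* ★ `setLIntegral_lt_top_of_subset_thinSet_two` (thin-set integration, `UnitaryGroupBorelThinSetIntegralTwo`) over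
  the every-`N` ray integral ★ `setLIntegral_rpow_neg_borelHeight_lt_top` fed by ★ `exists_ray_compact_of_export_two`;
* GLUE (ρ) ★ `exists_rootNorm_le_rpow_of_balance_two` — `‖(d₀⁻¹d₁)_∞‖ ≤ κ' · H(b)^{-2/[E:ℚ]}` on `S` above height 1;
* the dilated line domains `β⁻¹ n(𝓕⁻) β` of `N(F)` — ★ `isFundamentalDomain_borelConj_image_two`, ★
  `exists_isCompact_borelConj_lineDomain_subset_two` (`UnitaryGroupLineConjFundamentalDomainTwo`, B-p14 (g26));
* the ONE-FACTOR normal form ★ `exists_isCompact_forall_oneFactor_two` (`UnitaryGroupLineConjOneFactorTwo`),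
  re-assembled here with the compact direction set quantified FIRST
  (`exists_isCompact_lineDirections_forall_oneFactor_two`), as the row package needs it.
ONE geometric input remains a HYPOTHESIS, token-parallel to the `N = 3` closer's `hdepth` (its premise `hval`
in the letters of ★ `exists_isCompact_forall_oneFactor_two`): the LEVEL DEPTH of the dilated line domains on
the Siegel set — for every level `𝔫 ≠ 0` a rational `β ∈ B` with `π(b⁻¹ u b) ≡ 1 mod 𝔫` off the diagonal at
the finite places for all `b ∈ S` of height `≥ 1` and all `u ∈ β⁻¹ n(𝓕⁻) β` (the rational dilation
`β = d(ι m)`, brick `UnitaryGroupSiegelConjLevelDepthTwo`).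

WHAT IS PROVED.
* `exists_isCompact_lineDirections_forall_oneFactor_two` — the one-factor HEAD with the direction set first.
* **`truncatedKernelClassIntegrable_of_levelDepth_two`** (generic quadratic `E/F`, `c² = 1`, `c ≠ 1`,
  `[E:F] = 2`, unimodularity and the Iwasawa decomposition `hBK` as hypotheses) and
  **`truncatedKernelClassIntegrable_cm_of_levelDepth_two`** (at `(L⁺, L, complexConj)`, those discharged):
  for every class map with Rogawski's two axioms and every class `𝔬`, `[g] ↦ k^T_𝔬(g⁻¹)` is integrable on
  `G(F)∖U(J₂)(𝔸_F)` for all large `T`, from `hdepth` alone.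

HC_CM is proved only modulo the 7 printed citations until rung 0 closes.

## References

* J. Arthur, *A trace formula for reductive groups I*, Duke Math. J. 45 (1978), Thm. 7.1, §8 (pp. 947–950)
  [Arthur1978TraceFormulaI].
* J. D. Rogawski, *Automorphic Representations of Unitary Groups in Three Variables*, Ann. of Math. Stud.
  123 (1990), §2.2 (p. 13), §7.3 (p. 98) [Rogawski1990].
* A. Borel, *Introduction aux groupes arithmétiques* (1969), §12–§13 [Borel1969].
-/

set_option autoImplicit false

noncomputable section

open MeasureTheory Measure NumberField NumberField.mixedEmbedding IsDedekindDomain Set Topology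
open scoped NNReal ENNReal Pointwise MatrixGroups Classical

namespace Literature.NumberTheory.Automorphic

namespace UnitaryGroup

variable {F E : Type} [Field F] [NumberField F] [Field E] [NumberField E] [Algebra F E]
  {c : E ≃ₐ[F] E} {ι : Type*}

/-! ## §1 The one-factor normal form with the direction set first -/

/-- `archHom` is continuous (plumbing). [folklore] -/
private theorem continuous_archHom₁₃ : Continuous (archHom E) :=
  (continuous_ringEquiv_mixedSpace E).comp continuous_fst

/-- **THE ONE-FACTOR NORMAL FORM WITH THE DIRECTION SET FIRST** (★ `exists_isCompact_forall_oneFactor_two`,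
re-assembled with its compact set of directions — the unit multiples of `Ad(κ⁻¹)E₀₁`, `κ ∈ K_∞`, ★
`isCompact_lineDirections_two` — quantified BEFORE the compactum `K_N ⊆ N(𝔸_F)`: the row package `hrows` of ★
`truncatedKernelClassIntegrable_of_rows_two` fixes the direction set once, while `K_N = W₀(U)` varies with the
level). For compact `K_N` there is `C ≥ 0` such that for `b ∈ B(𝔸_F)`, `π k ∈ K_∞ · GL₂(𝒪̂_E)`, a level `𝔫`
and `u ∈ K_N` with `π(b⁻¹ub) ≡ 1 mod 𝔫` off the diagonal at the finite places:
`π((bk)⁻¹ u (bk)) = ι_∞(expGL(t•X)) · w`, `X ∈ S`, `w ∈ K(𝔫)`, `|t| ≤ C · ‖(d₀⁻¹d₁)_∞‖` (B-p14 (g26)'s proof of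
the HEAD, verbatim after the reordering). [cite: Rogawski1990, §2.2 (p. 13)] [cite: Arthur1978TraceFormulaI, §7] -/
theorem exists_isCompact_lineDirections_forall_oneFactor_two :
    ∃ S : Set (Matrix (Fin 2) (Fin 2) (mixedSpace E)), IsCompact S ∧
      ∀ {KN : Set (adelicUnipotent F E c 2)}, IsCompact KN → ∃ C : ℝ, 0 ≤ C ∧
      ∀ (b : borelAdelic F E c 2) (k : (quasiSplit F E c 2).Adelic),
        adelicVal F E c 2 _ k ∈ standardMaximalCompactGL 2 E →
        ∀ 𝔫 : Ideal (𝓞 E), ∀ u ∈ KN,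
          (∀ i j : Fin 2, i ≠ j → ∀ v : HeightOneSpectrum (𝓞 E),
            Valued.v ((((adelicVal F E c 2 _ ((b : (quasiSplit F E c 2).Adelic)⁻¹ *
                (u : (quasiSplit F E c 2).Adelic) * (b : (quasiSplit F E c 2).Adelic)) :
              GL (Fin 2) (AdeleRing (𝓞 E) E)) : Matrix (Fin 2) (Fin 2) (AdeleRing (𝓞 E) E)) i j).2 v) ≤
                idealRadius E v 𝔫 ∧
            Valued.v ((conjAdele F E c (((adelicVal F E c 2 _ ((b : (quasiSplit F E c 2).Adelic)⁻¹ *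
                (u : (quasiSplit F E c 2).Adelic) * (b : (quasiSplit F E c 2).Adelic)) :
              GL (Fin 2) (AdeleRing (𝓞 E) E)) : Matrix (Fin 2) (Fin 2) (AdeleRing (𝓞 E) E)) i j)).2 v) ≤
                idealRadius E v 𝔫) →
          ∃ (t : ℝ) (X : Matrix (Fin 2) (Fin 2) (mixedSpace E)) (w : GL (Fin 2) (AdeleRing (𝓞 E) E)),
            X ∈ S ∧ w ∈ principalCongruenceLevel 2 E 𝔫 ∧
            |t| ≤ C * ‖archHom E ((((diagUnit b.2 0)⁻¹ * diagUnit b.2 1 : (AdeleRing (𝓞 E) E)ˣ)) : AdeleRing (𝓞 E) E)‖ ∧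
            adelicVal F E c 2 _ (((b : (quasiSplit F E c 2).Adelic) * k)⁻¹ * (u : (quasiSplit F E c 2).Adelic) *
                ((b : (quasiSplit F E c 2).Adelic) * k)) =
              GLn.ofInfinite 2 E (expGL (t • X)) * w := by
  have hij : (((0 : Fin 2) : Fin 2) : ℕ) + 1 = (((1 : Fin 2) : Fin 2) : ℕ) := rfl
  have hN : 2 = 2 * (((0 : Fin 2) : Fin 2) : ℕ) + 2 := rfl
  refine ⟨{X : Matrix (Fin 2) (Fin 2) (mixedSpace E) |
        ∃ κ ∈ (Kinf 2 E : Set (GL (Fin 2) (mixedSpace E))), ∃ a : mixedSpace E, ‖a‖ ≤ 1 ∧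
          X = a • ((((κ⁻¹ : GL (Fin 2) (mixedSpace E)) : Matrix (Fin 2) (Fin 2) (mixedSpace E)) *
            Matrix.single (0 : Fin 2) (1 : Fin 2) 1 * (κ : Matrix (Fin 2) (Fin 2) (mixedSpace E))))},
    isCompact_lineDirections_two (isCompact_Kinf_holds 2 E), fun {KN} hKN => ?_⟩
  -- the archimedean size of the line coordinate is bounded on the compact `K_N`
  have hyc : Continuous fun u : adelicUnipotent F E c 2 =>
      archHom E ((middleCoord (F := F) (E := E) (c := c) (N := 2) (i := 0) (j := 1) hij hN u :
        traceZeroAdele F E c) : AdeleRing (𝓞 E) E) :=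
    (continuous_archHom₁₃ (E := E)).comp (continuous_subtype_val.comp
      (continuous_middleCoord_two (F := F) (E := E) (c := c) hij hN))
  obtain ⟨C₀, hC₀⟩ := hKN.exists_bound_of_continuousOn hyc.continuousOn
  refine ⟨max C₀ 0, le_max_right _ _, ?_⟩
  intro b k hk 𝔫 u hu hval
  obtain ⟨κ, hκ, κf, hκf, hkeq⟩ := exists_ofInfinite_mul_ofFinite_of_mem_standardMaximalCompactGL_two hk
  set w' : adelicUnipotent F E c 2 := ⟨(b : (quasiSplit F E c 2).Adelic)⁻¹ * (u : (quasiSplit F E c 2).Adelic) *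
    (b : (quasiSplit F E c 2).Adelic), conj_mem_adelicUnipotent b.2 u.2⟩ with hw'
  set a : mixedSpace E := archHom E ((middleCoord (F := F) (E := E) (c := c) (N := 2) (i := 0) (j := 1) hij hN w' :
    traceZeroAdele F E c) : AdeleRing (𝓞 E) E) with ha
  obtain ⟨t, X, hX, ht, e⟩ := exists_real_param_two (Kc := (Kinf 2 E : Set (GL (Fin 2) (mixedSpace E)))) hκ a
  refine ⟨t, X, GLn.ofFinite 2 E (κf⁻¹ * GLn.sndHom 2 E (adelicVal F E c 2 _
      ((b : (quasiSplit F E c 2).Adelic)⁻¹ * (u : (quasiSplit F E c 2).Adelic) * (b : (quasiSplit F E c 2).Adelic))) * κf),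
    hX, ofFinite_conj_sndHom_mem_principalCongruenceLevel_two w' 𝔫 hval hκf, ?_, ?_⟩
  · refine ht.trans ?_
    rw [ha, hw', coe_middleCoord_borelConj_two b u, map_mul]
    refine (norm_mul_le _ _).trans ?_
    rw [mul_comm]
    exact mul_le_mul_of_nonneg_right ((hC₀ u hu).trans (le_max_left _ _)) (norm_nonneg _)
  · rw [adelicVal_borel_mul_conj_eq_oneFactor_two b k κ κf hkeq u, ← ha, e]

/-! ## §2 `k^T_𝔬` integrable on `U(J₂)` from the one-factor normal form and the level depth -/

/-- **PER-CLASS INTEGRABILITY OF `k^T_𝔬` ON `U(J₂)` FROM THE ONE-FACTOR NORMAL FORM AND THE LEVEL DEPTH**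
(generic quadratic `E/F` with `c² = 1`, `c ≠ 1`, `[E:F] = 2`; unimodularity of `G(𝔸_F)` and the adelic Iwasawa
decomposition `hBK` as hypotheses).  The Siegel set `S = Ω · S_T · (B ∩ K_U)` of `U(J₂)`, its structure clause,
the GLUE (ρ), the thin-set integration over the ray and the dilated line domains `β⁻¹ n(𝓕⁻) β` with the
one-factor normal form (directions first) are assembled into the row package of ★
`truncatedKernelClassIntegrable_of_rows_two`; the one remaining input is the hypothesis `hdepth` — for every
level `𝔫 ≠ 0` a rational `β ∈ B` such that `π(b⁻¹ub) ≡ 1 mod 𝔫` off the diagonal at the finite places for all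
`b ∈ S` of height `≥ 1` and all `u ∈ β⁻¹ n(𝓕⁻) β`. [cite: Arthur1978TraceFormulaI, §8 (pp. 947–950)]
[cite: Rogawski1990, §2.2 (p. 13)] [cite: Borel1969, §13.1] -/
theorem truncatedKernelClassIntegrable_of_levelDepth_two (hc : c * c = 1) (hc1 : c ≠ 1)
    (h2 : Module.finrank F E = 2)
    (hunimod : ∀ [MeasurableSpace (quasiSplit F E c 2).Adelic] [BorelSpace (quasiSplit F E c 2).Adelic]
      (νG : Measure (quasiSplit F E c 2).Adelic), νG.IsHaarMeasure → νG.IsMulRightInvariant)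
    (hBK : ∀ g : (quasiSplit F E c 2).Adelic, ∃ b ∈ borelAdelic F E c 2, ∃ k : (quasiSplit F E c 2).Adelic,
      adelicVal F E c 2 ((StdForm.antidiagonal 2).over E) k ∈ standardMaximalCompactGL 2 E ∧ g = b * k)
    {cl : (quasiSplit F E c 2).arithmeticSubgroup → ι} (hcl : IsConjInvariant cl)
    (hclN : IsUnipotentInvariantOnBorel F E c 2 cl)
    (hdepth : ∀ {Ω ST : Set (borelAdelic F E c 2)}, IsCompact Ω → ∀ {W : Set (AdeleRing (𝓞 E) E)ˣ},
      IsCompact W → (∀ t ∈ ST, torusPart t = t) →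
      (∀ t ∈ ST, ∃ w ∈ W, ∃ s : ℝ, diagUnit t.2 0 = w * posRealIdele E (expUnitNNReal s)) →
      ∀ {𝔫 : Ideal (𝓞 E)}, 𝔫 ≠ 0 →
      ∃ β : borelAdelic F E c 2, (β : (quasiSplit F E c 2).Adelic) ∈ (quasiSplit F E c 2).arithmeticSubgroup ∧
        ∀ b ∈ Ω * ST * {k : borelAdelic F E c 2 |
            adelicVal F E c 2 ((StdForm.antidiagonal 2).over E) (k : (quasiSplit F E c 2).Adelic) ∈
              standardMaximalCompactGL 2 E},
        1 ≤ borelHeight (b : (quasiSplit F E c 2).Adelic) →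
        ∀ u ∈ (fun v : adelicUnipotent F E c 2 =>
            (⟨(β : (quasiSplit F E c 2).Adelic)⁻¹ * (v : (quasiSplit F E c 2).Adelic) * (β : (quasiSplit F E c 2).Adelic),
              conj_mem_adelicUnipotent β.2 v.2⟩ : adelicUnipotent F E c 2)) ''
            ((fun y : traceZeroAdele F E c =>
              middleRootUnipotent (F := F) (E := E) (c := c) (N := 2) (i := 0) (j := 1) rfl rfl
                (Multiplicative.ofAdd y)) '' traceZeroFundamentalDomain F E c),
          ∀ i j : Fin 2, i ≠ j → ∀ v : HeightOneSpectrum (𝓞 E),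
            Valued.v ((((adelicVal F E c 2 _ ((b : (quasiSplit F E c 2).Adelic)⁻¹ *
                (u : (quasiSplit F E c 2).Adelic) * (b : (quasiSplit F E c 2).Adelic)) :
              GL (Fin 2) (AdeleRing (𝓞 E) E)) : Matrix (Fin 2) (Fin 2) (AdeleRing (𝓞 E) E)) i j).2 v) ≤
                idealRadius E v 𝔫 ∧
            Valued.v ((conjAdele F E c (((adelicVal F E c 2 _ ((b : (quasiSplit F E c 2).Adelic)⁻¹ *
                (u : (quasiSplit F E c 2).Adelic) * (b : (quasiSplit F E c 2).Adelic)) :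
              GL (Fin 2) (AdeleRing (𝓞 E) E)) : Matrix (Fin 2) (Fin 2) (AdeleRing (𝓞 E) E)) i j)).2 v) ≤
                idealRadius E v 𝔫) :
    ∀ [MeasurableSpace (adelicUnipotent F E c 2)] [BorelSpace (adelicUnipotent F E c 2)]
      (ν : Measure (adelicUnipotent F E c 2)) [ν.IsHaarMeasure]
      (𝓕 : Set (adelicUnipotent F E c 2)),
      IsFundamentalDomain (rationalUnipotent F E c 2) 𝓕 ν →
        ∀ (μ : Measure (quasiSplit F E c 2).automorphicQuotient)
          [(quasiSplit F E c 2).IsAutomorphicMeasure μ]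
          (f : (quasiSplit F E c 2).Adelic → ℂ), IsQuasiSplitTest F E c 2 f →
          ∀ i : ι, ∃ T₀ : ℝ≥0, ∀ T : ℝ≥0, T₀ < T →
            Integrable ((quasiSplit F E c 2).quotFun (truncatedKernelClass ν 𝓕 T cl i f)) μ := by
  classical
  -- H-B4: the torus Siegel set of `U(J₂)`
  obtain ⟨ST, W, hSTc, hWc, hSTt, hexp, hSTcov, ⟨R₁, hR₁, hR⟩, ⟨κ, hbal⟩⟩ :=
    exists_torusSiegelSet_two F E c h2 hc1
  have hexp' : ∀ t ∈ ST, ∃ w ∈ W, ∃ s : ℝ, diagUnit t.2 0 = w * posRealIdele E (expUnitNNReal s) :=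
    fun t ht => by
      obtain ⟨w, hw, s, h0, -, -⟩ := hexp t ht
      exact ⟨w, hw, s, h0⟩
  -- (R1): `Ω`, the Siegel set `S = Ω · S_T · K_B` and the cover
  obtain ⟨Ω, hΩc, hΩN, hcov⟩ := exists_isCompact_cover_two hc hBK hSTcov
  set KB : Set (borelAdelic F E c 2) := {k : borelAdelic F E c 2 |
    adelicVal F E c 2 ((StdForm.antidiagonal 2).over E) (k : (quasiSplit F E c 2).Adelic) ∈
      standardMaximalCompactGL 2 E} with hKB
  set S : Set (borelAdelic F E c 2) := Ω * ST * KB with hS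
  -- (R2): the structure clause with the LETTER of H-B4
  obtain ⟨ΩG, hΩGc, R₁', hR₁'c, hSred⟩ := exists_isCompact_structure_of_mem_siegel_two hΩc hΩN hSTt hR₁ hR
  -- (R4a): the thin superset (joint (P1) + ★ `mul_mul_subset_thin`)
  obtain ⟨CN, hCNc, hCNN, hCN⟩ := exists_isCompact_conj_mem_two hWc hSTt hexp'
  have hthin := mul_mul_subset_thin (Ω := Ω) hΩN hSTt hCN
  obtain ⟨hSTKc, hSTKt, hΩCNc, -⟩ := isClosed_mul_setOf_torusPart hSTc hSTt hΩc hΩN hCNc hCNN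
  -- GLUE (ρ) and the ray
  obtain ⟨κ', hκ'0, hglue⟩ := exists_rootNorm_le_rpow_of_balance_two hΩN hSTt hbal
  obtain ⟨𝔎, ρ, h𝔎, hρc, hρ, hH, hSray⟩ := exists_ray_compact_of_export_two hc hWc hSTt hexp'
  -- the direction set of the one-factor normal form, FIXED before the rows are opened
  obtain ⟨Sdir, hSdir, h1⟩ := exists_isCompact_lineDirections_forall_oneFactor_two (F := F) (E := E) (c := c)
  -- (`apply`, not `refine … ?_`: the row package opens with instance binders)
  apply truncatedKernelClassIntegrable_of_rows_two hc hc1 hunimod hBK hcl hclN hSdir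
  intro mN bN mG bG ν hν
  haveI : LocallyCompactSpace (borelAdelic F E c 2) := locallyCompactSpace_borelAdelic
  haveI : T2Space (borelAdelic F E c 2) := t2Space_borelAdelic
  haveI : LocallyCompactSpace (torusInBorel F E c 2) :=
    (isTopSemidirect_borelAdelic (F := F) (E := E) (c := c) (N := 2)).isClosed_left.locallyCompactSpace
  set μB : Measure (borelAdelic F E c 2) := Measure.haar with hμB
  set μT : Measure (torusInBorel F E c 2) := Measure.haar with hμT
  refine ⟨μB, inferInstance, S, ΩG, R₁', 1, isClosed_mul_mul_setOf_adelicVal_mem hΩc hSTc,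
    mul_mem_mul_mul_setOf_adelicVal_mem, hcov, hΩGc, hR₁'c, fun b hb hH => hSred b hb hH.le,
    fun U hU => ?_⟩
  -- per level `U`: `𝔫` with `K(𝔫) ≤ U`, the rational `β` of the level depth, `𝓕₀ = β⁻¹ n(𝓕⁻) β ⊆ W₀`
  obtain ⟨𝔫, h𝔫, hKU, -⟩ := exists_principalCongruenceLevel_le_of_mem_finiteLevelsGL hU Filter.univ_mem
  obtain ⟨β, hβ, hval⟩ := hdepth hΩc hWc hSTt hexp' h𝔫
  obtain ⟨W₀, hW₀c, hW₀⟩ := exists_isCompact_borelConj_lineDomain_subset_two (F := F) (E := E) (c := c) rfl rfl hc β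
  obtain ⟨C, hC0, hgeo⟩ := h1 hW₀c
  letI : MeasurableSpace (AdeleRing (𝓞 E) E) := borel _
  haveI : BorelSpace (AdeleRing (𝓞 E) E) := ⟨rfl⟩
  refine ⟨(fun v : adelicUnipotent F E c 2 =>
      (⟨(β : (quasiSplit F E c 2).Adelic)⁻¹ * (v : (quasiSplit F E c 2).Adelic) * (β : (quasiSplit F E c 2).Adelic),
        conj_mem_adelicUnipotent β.2 v.2⟩ : adelicUnipotent F E c 2)) ''
      ((fun y : traceZeroAdele F E c =>
        middleRootUnipotent (F := F) (E := E) (c := c) (N := 2) (i := 0) (j := 1) rfl rfl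
          (Multiplicative.ofAdd y)) '' traceZeroFundamentalDomain F E c),
    W₀, fun b => C * ‖archHom E ((((diagUnit b.2 0)⁻¹ * diagUnit b.2 1 : (AdeleRing (𝓞 E) E)ˣ)) : AdeleRing (𝓞 E) E)‖,
    isFundamentalDomain_borelConj_image_two (F := F) (E := E) (c := c) rfl rfl hc β hβ ν, hW₀c, hW₀, ?_, ?_⟩
  · -- `hgeom`: the one-factor normal form on the Siegel set above height `1`
    intro b hb hHb k hk u hu
    obtain ⟨t, X, w, hX, hw, ht, e⟩ := hgeo b k hk 𝔫 u (hW₀ hu) (hval b hb hHb.le u hu)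
    exact ⟨t, X, w, hX, hKU hw, ht, e⟩
  · -- `hH10`: thin-set integration (W3) of the GLUE (ρ) majorant over the ray (every-`N` ray integral)
    have hd0 : (0 : ℝ) < 2 / (Module.finrank ℚ E : ℝ) :=
      div_pos two_pos (by exact_mod_cast Module.finrank_pos)
    have hfr : (0 : ℝ) < (Module.finrank ℚ E : ℝ) := by exact_mod_cast Module.finrank_pos
    have hCκ : 0 ≤ C * κ' := mul_nonneg hC0 hκ'0
    have hgm : Measurable fun x : ℝ≥0 =>
        ENNReal.ofReal (C * κ') * ENNReal.ofReal ((x : ℝ) ^ (-(2 / (Module.finrank ℚ E : ℝ)))) :=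
      measurable_const.mul (measurable_coe_nnreal_real.pow_const _).ennreal_ofReal
    refine setLIntegral_lt_top_of_subset_thinSet_two hc hc1 μB μT
      (isClosed_mul_mul_setOf_adelicVal_mem hΩc hSTc).measurableSet hSTKc.measurableSet hΩCNc
      (T₀ := 1) (fun b hb _ => hthin hb) hgm (fun b hb hHb => ?_) (fun T hT => ?_)
    · rw [← ENNReal.ofReal_mul hCκ, mul_assoc]
      exact ENNReal.ofReal_le_ofReal (mul_le_mul_of_nonneg_left (hglue b hb hHb.le) hC0)
    · rw [lintegral_const_mul' _ _ ENNReal.ofReal_ne_top]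
      exact ENNReal.mul_lt_top ENNReal.ofReal_lt_top
        (setLIntegral_rpow_neg_borelHeight_lt_top μT h𝔎 hρc hρ hfr hH hSray (lt_trans one_pos hT) hd0)

/-- **PER-CLASS INTEGRABILITY OF `k^T_𝔬` ON `U(J₂)` FROM THE LEVEL DEPTH, AT A CM EXTENSION** — `c² = 1`,
`c ≠ 1`, `[L:L⁺] = 2` (★ `Algebra.IsQuadraticExtension.finrank_eq_two`),
unimodularity (★ `forall_isHaarMeasure_isMulRightInvariant_quasiSplit_cm_two`, H-B2) and the adelic Iwasawa
decomposition (★ `exists_mem_borelAdelic_mul_mem_standardMaximalCompactGL_cm`, every `N`) DISCHARGED: the LAW 1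
per-class statement for the H-side's `U(Φ₂) = U(J₂)` follows from `hdepth` (level depth of the dilated line
domains on the Siegel set) alone. [cite: Arthur1978TraceFormulaI, §8 (pp. 947–950)]
[cite: Rogawski1990, §2.2 (p. 13)] -/
theorem truncatedKernelClassIntegrable_cm_of_levelDepth_two (L : Type) [Field L] [NumberField L] [IsCMField L]
    {cl : (quasiSplit (↥(maximalRealSubfield L)) L (IsCMField.complexConj L) 2).arithmeticSubgroup → ι}
    (hcl : IsConjInvariant cl)
    (hclN : IsUnipotentInvariantOnBorel (↥(maximalRealSubfield L)) L (IsCMField.complexConj L) 2 cl)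
    (hdepth : ∀ {Ω ST : Set (borelAdelic (↥(maximalRealSubfield L)) L (IsCMField.complexConj L) 2)}, IsCompact Ω →
      ∀ {W : Set (AdeleRing (𝓞 L) L)ˣ}, IsCompact W → (∀ t ∈ ST, torusPart t = t) →
      (∀ t ∈ ST, ∃ w ∈ W, ∃ s : ℝ, diagUnit t.2 0 = w * posRealIdele L (expUnitNNReal s)) →
      ∀ {𝔫 : Ideal (𝓞 L)}, 𝔫 ≠ 0 →
      ∃ β : borelAdelic (↥(maximalRealSubfield L)) L (IsCMField.complexConj L) 2,
        (β : (quasiSplit (↥(maximalRealSubfield L)) L (IsCMField.complexConj L) 2).Adelic) ∈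
          (quasiSplit (↥(maximalRealSubfield L)) L (IsCMField.complexConj L) 2).arithmeticSubgroup ∧
        ∀ b ∈ Ω * ST * {k : borelAdelic (↥(maximalRealSubfield L)) L (IsCMField.complexConj L) 2 |
            adelicVal (↥(maximalRealSubfield L)) L (IsCMField.complexConj L) 2 ((StdForm.antidiagonal 2).over L)
              (k : (quasiSplit (↥(maximalRealSubfield L)) L (IsCMField.complexConj L) 2).Adelic) ∈
              standardMaximalCompactGL 2 L},
        1 ≤ borelHeight (b : (quasiSplit (↥(maximalRealSubfield L)) L (IsCMField.complexConj L) 2).Adelic) →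
        ∀ u ∈ (fun v : adelicUnipotent (↥(maximalRealSubfield L)) L (IsCMField.complexConj L) 2 =>
            (⟨(β : (quasiSplit (↥(maximalRealSubfield L)) L (IsCMField.complexConj L) 2).Adelic)⁻¹ *
                (v : (quasiSplit (↥(maximalRealSubfield L)) L (IsCMField.complexConj L) 2).Adelic) *
                (β : (quasiSplit (↥(maximalRealSubfield L)) L (IsCMField.complexConj L) 2).Adelic),
              conj_mem_adelicUnipotent β.2 v.2⟩ :
              adelicUnipotent (↥(maximalRealSubfield L)) L (IsCMField.complexConj L) 2)) ''
            ((fun y : traceZeroAdele (↥(maximalRealSubfield L)) L (IsCMField.complexConj L) =>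
              middleRootUnipotent (F := ↥(maximalRealSubfield L)) (E := L) (c := IsCMField.complexConj L)
                (N := 2) (i := 0) (j := 1) rfl rfl (Multiplicative.ofAdd y)) ''
              traceZeroFundamentalDomain (↥(maximalRealSubfield L)) L (IsCMField.complexConj L)),
          ∀ i j : Fin 2, i ≠ j → ∀ v : HeightOneSpectrum (𝓞 L),
            Valued.v ((((adelicVal (↥(maximalRealSubfield L)) L (IsCMField.complexConj L) 2 _
                ((b : (quasiSplit (↥(maximalRealSubfield L)) L (IsCMField.complexConj L) 2).Adelic)⁻¹ *
                (u : (quasiSplit (↥(maximalRealSubfield L)) L (IsCMField.complexConj L) 2).Adelic) *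
                (b : (quasiSplit (↥(maximalRealSubfield L)) L (IsCMField.complexConj L) 2).Adelic)) :
              GL (Fin 2) (AdeleRing (𝓞 L) L)) : Matrix (Fin 2) (Fin 2) (AdeleRing (𝓞 L) L)) i j).2 v) ≤
                idealRadius L v 𝔫 ∧
            Valued.v ((conjAdele (↥(maximalRealSubfield L)) L (IsCMField.complexConj L)
                (((adelicVal (↥(maximalRealSubfield L)) L (IsCMField.complexConj L) 2 _
                ((b : (quasiSplit (↥(maximalRealSubfield L)) L (IsCMField.complexConj L) 2).Adelic)⁻¹ *
                (u : (quasiSplit (↥(maximalRealSubfield L)) L (IsCMField.complexConj L) 2).Adelic) *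
                (b : (quasiSplit (↥(maximalRealSubfield L)) L (IsCMField.complexConj L) 2).Adelic)) :
              GL (Fin 2) (AdeleRing (𝓞 L) L)) : Matrix (Fin 2) (Fin 2) (AdeleRing (𝓞 L) L)) i j)).2 v) ≤
                idealRadius L v 𝔫) :
    ∀ [MeasurableSpace (adelicUnipotent (↥(maximalRealSubfield L)) L (IsCMField.complexConj L) 2)]
      [BorelSpace (adelicUnipotent (↥(maximalRealSubfield L)) L (IsCMField.complexConj L) 2)]
      (ν : Measure (adelicUnipotent (↥(maximalRealSubfield L)) L (IsCMField.complexConj L) 2)) [ν.IsHaarMeasure]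
      (𝓕 : Set (adelicUnipotent (↥(maximalRealSubfield L)) L (IsCMField.complexConj L) 2)),
      IsFundamentalDomain (rationalUnipotent (↥(maximalRealSubfield L)) L (IsCMField.complexConj L) 2) 𝓕 ν →
        ∀ (μ : Measure (quasiSplit (↥(maximalRealSubfield L)) L (IsCMField.complexConj L) 2).automorphicQuotient)
          [(quasiSplit (↥(maximalRealSubfield L)) L (IsCMField.complexConj L) 2).IsAutomorphicMeasure μ]
          (f : (quasiSplit (↥(maximalRealSubfield L)) L (IsCMField.complexConj L) 2).Adelic → ℂ),
          IsQuasiSplitTest (↥(maximalRealSubfield L)) L (IsCMField.complexConj L) 2 f →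
          ∀ i : ι, ∃ T₀ : ℝ≥0, ∀ T : ℝ≥0, T₀ < T →
            Integrable ((quasiSplit (↥(maximalRealSubfield L)) L (IsCMField.complexConj L) 2).quotFun
              (truncatedKernelClass ν 𝓕 T cl i f)) μ :=
  truncatedKernelClassIntegrable_of_levelDepth_two (complexConj_mul_complexConj L) (IsCMField.complexConj_ne_one L)
    (Algebra.IsQuadraticExtension.finrank_eq_two (↥(maximalRealSubfield L)) L)
    (forall_isHaarMeasure_isMulRightInvariant_quasiSplit_cm_two L)
    (exists_mem_borelAdelic_mul_mem_standardMaximalCompactGL_cm L) hcl hclN hdepth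

end UnitaryGroup

end Literature.NumberTheory.Automorphic
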